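import Summits.ABC.StewartYu.PadicW80ParLB
import HarnessLib

/-!
# The `(log p)`-normalised parameter record `PadicW80ParL` — part C of the inequalities

Support file (theorems only; no named facts), cell `abc-stewartyu` (p1, stub S5 of memo-03 §4): twin of
`PadicW80ParC.lean` on the `ℓ`-normalised record. `log U ≤ 10W⋆` (now also `log Mcl ≤ ℓ ≤ W⋆` and
`nG ≤ G ≤ 3W⋆`), `log T ≤ 10W⋆`, the height budget `S₀(∑LⱼVⱼ + L_θV_θ) ≤ 𝔘/(2c_L')` (formula-identical),
`h G ≤ W⋆ + G`, `h L_b G ≤ 𝔘/c_L + W⋆ + G` (so `h L_b · ℓ ≤ h L_b · G` is `(log p)`-safe: the floor `ℓ ≤ G`),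
`h L_b ≤ 𝔘/c_L + 4W⋆`, `X ≤ 33U/(c_L' m V_θ)`, `Aᵐ m^{2m+3} ≤ e^{3G}`, `∏V ≤ e^G`, `G² ≤ e^G`.
Proofs are the landed ones; design note HOME/p1/S5-logp-ledger.md. [cite: Waldschmidt1980, §3.2–3.5 (pp. 264–274)]
-/

noncomputable section

open Finset Real
open Literature.NumberTheory.Transcendental Literature.NumberTheory.Transcendental.Waldschmidt1980

namespace Summit.ABC.StewartYu

open PadicW80Par (cTp cSp cLp cLp' Ap mRp)

namespace PadicW80ParL

variable {d : ℕ} (P : PadicW80ParL d)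

/-- **`log U ≤ 10 W⋆`**: `U = Mcl·Aᵐ m^{2m+3}/m! (∏nV)nV_θ W⋆ nG` and each factor is `exp(O(W⋆))`
(`log Mcl ≤ ℓ ≤ W⋆`, `m log Ap ≤ 4W⋆`, `(2m+1) log m ≤ W⋆`, `∑ log nVⱼ + log nV_θ ≤ W⋆`, `log W⋆ ≤ W⋆`, `log nG ≤ 2W⋆`).
[folklore] -/
theorem log_U_le : Real.log P.Uℓ ≤ 10 * P.Wstarℓ := by
  have hW := P.one_le_Wstar; have hm := two_le_mR P; have hm0 := mR_pos P
  have hG := P.one_le_G; have hGW := P.G_le_three_Wstar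
  have hVθ := P.hVθ1; have hV := P.one_le_prodVs; have hVm := P.one_le_Vmax
  have h9 := P.nine_mR_le_Wstar
  have hml := P.mlog_le_Wstar
  -- `U ≤ exp(10 W⋆)` multiplicatively
  apply (Real.log_le_iff_le_exp P.U_pos).mpr
  -- factor bounds
  have f1 : Ap ^ (d + 1) ≤ Real.exp (4 * P.Wstarℓ) := by
    -- `Ap^m = 2^{50 m} ≤ e^{35 m} ≤ e^{4 W⋆}` since `9m ≤ W⋆`
    unfold Ap
    have h2 : (2 : ℝ) ^ 50 ≤ Real.exp 35 := by
      have := Real.exp_one_gt_d9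
      have h3 : (2.7182818283 : ℝ) ^ 35 ≤ Real.exp 1 ^ 35 := by gcongr
      rw [← Real.exp_nat_mul] at h3
      norm_num at h3 ⊢
      linarith
    calc ((2 : ℝ) ^ 50) ^ (d + 1) ≤ (Real.exp 35) ^ (d + 1) := by gcongr
      _ = Real.exp (35 * mRp d) := by rw [← Real.exp_nat_mul]; unfold mRp; push_cast; ring_nf
      _ ≤ Real.exp (4 * P.Wstarℓ) := Real.exp_le_exp.mpr (by nlinarith)
  have f2 : mRp d ^ (2 * d + 3) / (d + 1).factorial ≤ Real.exp (P.Wstarℓ) := by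
    -- `m^{2m+1}/m! ≤ m^{m+1} e^{m}` (`m^m ≤ e^m m!`) and `(m+1) log m + m ≤ m (9 + log m) ≤ W⋆`
    have hfacpos : (0 : ℝ) < (d + 1).factorial := by exact_mod_cast Nat.factorial_pos _
    have hst := CW77.pow_self_le_exp_mul_factorial (d + 1)
    have em : ((d + 1 : ℕ) : ℝ) = mRp d := by unfold mRp; push_cast; ring
    rw [em] at hst
    have hlogm : 0 ≤ Real.log (mRp d) := Real.log_nonneg (by linarith)
    have hlog13 : Real.log (2 ^ 13 * mRp d * P.Vm) = Real.log (2 ^ 13 * P.Vm) + Real.log (mRp d) := by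
      rw [show (2 : ℝ) ^ 13 * mRp d * P.Vm = (2 ^ 13 * P.Vm) * mRp d by ring, Real.log_mul (by positivity) hm0.ne']
    have h13 : 9 ≤ Real.log (2 ^ 13 * P.Vm) := by
      have e9 : Real.exp 9 ≤ 2 ^ 13 * P.Vm := by
        have := Real.exp_one_lt_d9
        calc Real.exp 9 = Real.exp 1 ^ 9 := by rw [← Real.exp_nat_mul]; norm_num
          _ ≤ (2.7182818286 : ℝ) ^ 9 := by gcongr
          _ ≤ 2 ^ 13 * 1 := by norm_num
          _ ≤ 2 ^ 13 * P.Vm := by gcongr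
      calc (9 : ℝ) = Real.log (Real.exp 9) := (Real.log_exp 9).symm
        _ ≤ _ := Real.log_le_log (Real.exp_pos _) e9
    -- `m^{2d+3}/(d+1)! ≤ m^{d+2} e^{d+1}`
    have h1 : mRp d ^ (2 * d + 3) / (d + 1).factorial ≤ mRp d ^ (d + 2) * Real.exp 1 ^ (d + 1) := by
      rw [div_le_iff₀ hfacpos]
      calc mRp d ^ (2 * d + 3) = mRp d ^ (d + 2) * mRp d ^ (d + 1) := by rw [← pow_add]; ring_nf
        _ ≤ mRp d ^ (d + 2) * (Real.exp 1 ^ (d + 1) * (d + 1).factorial) :=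
            mul_le_mul_of_nonneg_left hst (by positivity)
        _ = mRp d ^ (d + 2) * Real.exp 1 ^ (d + 1) * (d + 1).factorial := by ring
    refine h1.trans ?_
    have e1 : mRp d ^ (d + 2) * Real.exp 1 ^ (d + 1) = Real.exp ((d + 2 : ℕ) * Real.log (mRp d) + (d + 1 : ℕ)) := by
      rw [Real.exp_add, Real.exp_nat_mul, Real.exp_log hm0, ← Real.exp_nat_mul, mul_one]
    rw [e1]
    apply Real.exp_le_exp.mpr
    have e2 : ((d + 2 : ℕ) : ℝ) = mRp d + 1 := by unfold mRp; push_cast; ring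
    have e3 : ((d + 1 : ℕ) : ℝ) = mRp d := em
    rw [e2, e3]
    have hlogm' : Real.log (mRp d) ≤ mRp d := (Real.log_le_sub_one_of_pos hm0).trans (by linarith)
    calc (mRp d + 1) * Real.log (mRp d) + mRp d ≤ mRp d * (9 + Real.log (mRp d)) := by nlinarith
      _ ≤ mRp d * Real.log (2 ^ 13 * mRp d * P.Vm) := by
          rw [hlog13]; exact mul_le_mul_of_nonneg_left (by linarith) hm0.le
      _ ≤ P.Wstarℓ := hml
  have f3 : (∏ j, P.nV j) * P.nVθ ≤ Real.exp P.Wstarℓ := by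
    -- `nVⱼ ≤ Vⱼ ≤ V_max`, `nV_θ ≤ V_θ ≤ V_max`, so the product is `≤ Vm^{d+1} ≤ exp(m log(2^13 m Vm)) ≤ exp W⋆`
    have hVle : ∀ j, P.nV j ≤ P.Vm := fun j => (P.nV_le j).trans (P.hVmax j)
    have h1 : (∏ j, P.nV j) ≤ P.Vm ^ d := by
      calc (∏ j, P.nV j) ≤ ∏ _j : Fin d, P.Vm :=
            prod_le_prod (fun j _ => le_trans zero_le_one (P.one_le_nV j)) fun j _ => hVle j
        _ = P.Vm ^ d := by rw [prod_const, card_univ, Fintype.card_fin]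
    have hVm1 := P.hVmax1
    have hVθ0 : 0 < P.Vm := by linarith
    calc (∏ j, P.nV j) * P.nVθ ≤ P.Vm ^ d * P.Vm :=
          mul_le_mul h1 (P.nVθ_le.trans P.hVθmax) (le_trans zero_le_one P.one_le_nVθ) (by positivity)
      _ = P.Vm ^ (d + 1) := by rw [pow_succ]
      _ = Real.exp ((d + 1 : ℕ) * Real.log P.Vm) := by rw [Real.exp_nat_mul, Real.exp_log hVθ0]
      _ ≤ Real.exp P.Wstarℓ := by
          apply Real.exp_le_exp.mpr
          have e : ((d + 1 : ℕ) : ℝ) = mRp d := by unfold mRp; push_cast; ring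
          rw [e]
          have hlv : Real.log P.Vm ≤ Real.log (2 ^ 13 * mRp d * P.Vm) := by
            apply Real.log_le_log hVθ0
            have : (1 : ℝ) ≤ 2 ^ 13 * mRp d := by nlinarith
            nlinarith
          have hlv0 : 0 ≤ Real.log P.Vm := Real.log_nonneg hVm1
          calc mRp d * Real.log P.Vm ≤ mRp d * Real.log (2 ^ 13 * mRp d * P.Vm) := mul_le_mul_of_nonneg_left hlv hm0.le
            _ ≤ P.Wstarℓ := hml
  have f4 : P.Wstarℓ ≤ Real.exp P.Wstarℓ := by linarith [Real.add_one_le_exp P.Wstarℓ]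
  have f5 : P.nGℓ ≤ Real.exp (2 * P.Wstarℓ) := by
    -- `nG ≤ G ≤ 3W⋆ ≤ e^{2W⋆}` (`3x ≤ 1 + 2x + 2x² ≤ e^{2x}` for `x ≥ 1`)
    have hnG : P.nGℓ ≤ P.Gℓ := by unfold nGℓ; exact div_le_self P.G_pos.le P.hℓ
    have hq := Real.quadratic_le_exp_of_nonneg (show 0 ≤ 2 * P.Wstarℓ by linarith)
    nlinarith
  have f0 : P.Mcl ≤ Real.exp P.Wstarℓ := by
    -- `log Mcl ≤ ℓ ≤ W⋆`
    have hM := P.hMcl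
    have h1 : Real.log P.Mcl ≤ P.Wstarℓ := P.hMclℓ.trans P.ℓ_le_Wstar
    calc P.Mcl = Real.exp (Real.log P.Mcl) := (Real.exp_log (by linarith)).symm
      _ ≤ Real.exp P.Wstarℓ := Real.exp_le_exp.mpr h1
  unfold Uℓ
  calc P.Mcl * Ap ^ (d + 1) * (mRp d ^ (2 * d + 3) / (d + 1).factorial) * ((∏ j, P.nV j) * P.nVθ) * P.Wstarℓ * P.nGℓ
      ≤ Real.exp P.Wstarℓ * Real.exp (4 * P.Wstarℓ) * Real.exp P.Wstarℓ * Real.exp P.Wstarℓ * Real.exp P.Wstarℓ *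
          Real.exp (2 * P.Wstarℓ) := by
        have := P.U_pos; have := P.hMcl
        have h0 : 0 ≤ mRp d ^ (2 * d + 3) / (d + 1).factorial := by positivity
        have h00 : 0 ≤ (∏ j, P.nV j) * P.nVθ := le_trans zero_le_one P.one_le_prodnVVθ
        have hA : (0 : ℝ) ≤ Ap ^ (d + 1) := by unfold Ap; positivity
        have hnG0 : (0 : ℝ) ≤ P.nGℓ := P.nG_pos.le
        gcongr
    _ = Real.exp (10 * P.Wstarℓ) := by simp only [← Real.exp_add]; ring_nf

/-- `log T ≤ 10 W⋆` (`T ≤ U`). [folklore] -/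
theorem log_T_le : Real.log P.Tℓ ≤ 10 * P.Wstarℓ := by
  have hT : (P.Tℓ : ℝ) ≤ P.Uℓ := by
    have h := P.T_le; have hW := P.one_le_Wstar; have hU := P.U_pos
    refine h.trans (div_le_self hU.le ?_)
    unfold cTp
    have : (1 : ℝ) ≤ 2 ^ (d + 1) := one_le_pow₀ (by norm_num)
    nlinarith
  exact (Real.log_le_log P.T_pos hT).trans P.log_U_le

/-! ### The height exponents: `S₀ (∑ LⱼVⱼ + L_θ V_θ) ≤ 𝔘/(2 c_L')` -/

/-- `S₀ Lⱼ Vⱼ ≤ 𝔘/(2 c_L' m)`. [folklore] -/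
theorem S₀LV_le_one (j : Fin d) : (P.S₀ℓ : ℝ) * (P.Lℓ j * P.V j) ≤ P.𝔘ℓ / (2 * cLp' * mRp d) := by
  have hL : (P.Lℓ j : ℝ) ≤ P.Uℓ / (cLp' * mRp d * 2 ^ (d + 2) * P.S₀ℓ * P.V j) := by
    unfold Lℓ
    exact Nat.floor_le (div_nonneg P.U_pos.le (by unfold cLp'; have := mR_pos P; have := P.S₀_pos; have := P.hV j; positivity))
  have hS := P.S₀_pos; have hV := P.hV j; have hm := mR_pos P
  unfold cLp' at *
  rw [le_div_iff₀ (by positivity)] at hL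
  rw [le_div_iff₀ (by positivity)]
  rw [P.U_eq] at hL
  have key : ((P.S₀ℓ : ℝ) * (P.Lℓ j * P.V j) * (2 * 2 ^ 12 * mRp d)) * 2 ^ (d + 1) ≤ P.𝔘ℓ * 2 ^ (d + 1) := by
    calc ((P.S₀ℓ : ℝ) * (P.Lℓ j * P.V j) * (2 * 2 ^ 12 * mRp d)) * 2 ^ (d + 1)
        = P.Lℓ j * (2 ^ 12 * mRp d * 2 ^ (d + 2) * P.S₀ℓ * P.V j) := by rw [pow_succ]; ring
      _ ≤ 2 ^ (d + 1) * P.𝔘ℓ := hL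
      _ = P.𝔘ℓ * 2 ^ (d + 1) := by ring
  exact le_of_mul_le_mul_right key (by positivity)

/-- `S₀ L_θ V_θ ≤ 𝔘/(2 c_L' m)`. [folklore] -/
theorem S₀LθVθ_le : (P.S₀ℓ : ℝ) * (P.Lθℓ * P.Vθ) ≤ P.𝔘ℓ / (2 * cLp' * mRp d) := by
  have hL := P.Lθ_le
  have hS := P.S₀_pos; have hV := P.hVθ1; have hm := mR_pos P
  unfold cLp' at *
  rw [le_div_iff₀ (by positivity)] at hL
  rw [le_div_iff₀ (by positivity)]
  rw [P.U_eq] at hL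
  have key : ((P.S₀ℓ : ℝ) * (P.Lθℓ * P.Vθ) * (2 * 2 ^ 12 * mRp d)) * 2 ^ (d + 1) ≤ P.𝔘ℓ * 2 ^ (d + 1) := by
    calc ((P.S₀ℓ : ℝ) * (P.Lθℓ * P.Vθ) * (2 * 2 ^ 12 * mRp d)) * 2 ^ (d + 1)
        = P.Lθℓ * (2 ^ 12 * mRp d * 2 ^ (d + 2) * P.S₀ℓ * P.Vθ) := by rw [pow_succ]; ring
      _ ≤ 2 ^ (d + 1) * P.𝔘ℓ := hL
      _ = P.𝔘ℓ * 2 ^ (d + 1) := by ring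
  exact le_of_mul_le_mul_right key (by positivity)

/-- **`S₀ (∑ⱼ LⱼVⱼ + L_θ V_θ) ≤ 𝔘/(2 c_L')`** (`d + 1 = m` terms of size `𝔘/(2c_L' m)`).
[cite: Waldschmidt1980, (3.11) (p. 265)] -/
theorem S₀LV_le : (P.S₀ℓ : ℝ) * ((∑ j, P.Lℓ j * P.V j) + P.Lθℓ * P.Vθ) ≤ P.𝔘ℓ / (2 * cLp') := by
  have h1 : ∀ j, (P.S₀ℓ : ℝ) * (P.Lℓ j * P.V j) ≤ P.𝔘ℓ / (2 * cLp' * mRp d) := P.S₀LV_le_one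
  have h2 := P.S₀LθVθ_le
  have hm := mR_pos P
  calc (P.S₀ℓ : ℝ) * ((∑ j, P.Lℓ j * P.V j) + P.Lθℓ * P.Vθ)
      = (∑ j, (P.S₀ℓ : ℝ) * (P.Lℓ j * P.V j)) + P.S₀ℓ * (P.Lθℓ * P.Vθ) := by rw [mul_add, mul_sum]
    _ ≤ (∑ _j : Fin d, P.𝔘ℓ / (2 * cLp' * mRp d)) + P.𝔘ℓ / (2 * cLp' * mRp d) := add_le_add (sum_le_sum fun j _ => h1 j) h2
    _ = (d + 1) * (P.𝔘ℓ / (2 * cLp' * mRp d)) := by rw [sum_const, card_univ, Fintype.card_fin]; simp; ring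
    _ = P.𝔘ℓ / (2 * cLp') := by unfold mRp cLp'; field_simp

/-- `L_θ S₀ ≤ 𝔘/2¹⁴` (`V_θ ≥ 1`, `m ≥ 2`, `c_L' = 2¹²`). [folklore] -/
theorem LθS₀_le : (P.Lθℓ : ℝ) * P.S₀ℓ ≤ P.𝔘ℓ / 2 ^ 14 := by
  have h := P.S₀LθVθ_le
  have hV := P.hVθ1; have hm := two_le_mR P; have hS := P.S₀_pos; have hU := P.𝔘_pos
  have hL : (0 : ℝ) ≤ P.Lθℓ := Nat.cast_nonneg _
  unfold cLp' at h
  rw [le_div_iff₀ (by positivity)] at h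
  rw [le_div_iff₀ (by positivity)]
  have h1 : (P.Lθℓ : ℝ) * P.S₀ℓ * 1 ≤ P.Lθℓ * P.S₀ℓ * P.Vθ := mul_le_mul_of_nonneg_left hV (by positivity)
  have h2 : (P.Lθℓ : ℝ) * P.S₀ℓ * (2 ^ 14) ≤ P.S₀ℓ * (P.Lθℓ * P.Vθ) * (2 * 2 ^ 12 * mRp d) := by
    calc (P.Lθℓ : ℝ) * P.S₀ℓ * 2 ^ 14 = (P.Lθℓ * P.S₀ℓ * 1) * (2 * 2 ^ 12 * 2) := by ring
      _ ≤ (P.Lθℓ * P.S₀ℓ * P.Vθ) * (2 * 2 ^ 12 * mRp d) := by gcongr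
      _ = P.S₀ℓ * (P.Lθℓ * P.Vθ) * (2 * 2 ^ 12 * mRp d) := by ring
  linarith

/-- `L_θ S₀ ℓ ≤ 𝔘/2¹⁴` (the floor `V_θ ≥ ℓ`, `m ≥ 2`, `c_L' = 2¹²`): the form the `(log p)`-normalised count needs.
[folklore] -/
theorem LθS₀ℓ_le : (P.Lθℓ : ℝ) * P.S₀ℓ * P.ℓ ≤ P.𝔘ℓ / 2 ^ 14 := by
  have h := P.S₀LθVθ_le
  have hV := P.hVθℓ; have hm := two_le_mR P; have hS := P.S₀_pos; have hU := P.𝔘_pos; have hℓ := P.ℓ_pos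
  have hL : (0 : ℝ) ≤ P.Lθℓ := Nat.cast_nonneg _
  have hVθ0 : (0 : ℝ) ≤ P.Vθ := le_trans zero_le_one P.hVθ1
  unfold cLp' at h
  rw [le_div_iff₀ (by positivity)] at h
  rw [le_div_iff₀ (by positivity)]
  have h1 : (P.Lθℓ : ℝ) * P.S₀ℓ * P.ℓ ≤ P.Lθℓ * P.S₀ℓ * P.Vθ := mul_le_mul_of_nonneg_left hV (by positivity)
  have h2 : (P.Lθℓ : ℝ) * P.S₀ℓ * P.ℓ * (2 ^ 14) ≤ P.S₀ℓ * (P.Lθℓ * P.Vθ) * (2 * 2 ^ 12 * mRp d) := by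
    calc (P.Lθℓ : ℝ) * P.S₀ℓ * P.ℓ * 2 ^ 14 = (P.Lθℓ * P.S₀ℓ * P.ℓ) * (2 * 2 ^ 12 * 2) := by ring
      _ ≤ (P.Lθℓ * P.S₀ℓ * P.Vθ) * (2 * 2 ^ 12 * mRp d) := by gcongr
      _ = P.S₀ℓ * (P.Lθℓ * P.Vθ) * (2 * 2 ^ 12 * mRp d) := by ring
  linarith

/-! ### The `Δ`-polynomials: `h`, `L_b` -/

/-- `W⋆/G < h` (as reals). [folklore] -/
theorem Wstar_div_G_lt_hpar : P.Wstarℓ / P.Gℓ < P.hparℓ := by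
  unfold hparℓ; push_cast; exact Nat.lt_floor_add_one _

/-- `1 ≤ h`. [folklore] -/
theorem one_le_hpar : 1 ≤ P.hparℓ := Nat.le_add_left 1 _

/-- `0 < h` (real). [folklore] -/
theorem hpar_pos : (0 : ℝ) < P.hparℓ := by have := P.one_le_hpar; exact_mod_cast this

/-- `h G ≤ W⋆ + G`. [folklore] -/
theorem hparG_le : (P.hparℓ : ℝ) * P.Gℓ ≤ P.Wstarℓ + P.Gℓ := by
  unfold hparℓ; push_cast
  have hG := P.G_pos
  have h1 : (⌊P.Wstarℓ / P.Gℓ⌋₊ : ℝ) ≤ P.Wstarℓ / P.Gℓ := Nat.floor_le (div_nonneg (by linarith [P.one_le_Wstar]) hG.le)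
  have : (⌊P.Wstarℓ / P.Gℓ⌋₊ : ℝ) * P.Gℓ ≤ P.Wstarℓ := by rwa [le_div_iff₀ hG] at h1
  nlinarith

/-- `h ≤ 3 W⋆` (indeed `h ≤ W⋆/G + 1 ≤ W⋆ + 1`; so `h` is lower-order). [folklore] -/
theorem hpar_le : (P.hparℓ : ℝ) ≤ 3 * P.Wstarℓ := by
  have h := P.hparG_le; have hG := P.one_le_G; have hW := P.one_le_Wstar; have h0 := P.hpar_pos
  have h1 : ((P.hparℓ : ℝ) - 1) * P.Gℓ ≤ P.Wstarℓ := by nlinarith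
  have h2 : (P.hparℓ : ℝ) - 1 ≤ P.Wstarℓ := by
    have h1' : (P.hparℓ : ℝ) - 1 ≤ ((P.hparℓ : ℝ) - 1) * P.Gℓ := by
      have h00 : (0 : ℝ) ≤ (P.hparℓ : ℝ) - 1 := by
        have := P.one_le_hpar; have : (1 : ℝ) ≤ P.hparℓ := by exact_mod_cast this
        linarith
      nlinarith
    linarith
  linarith

/-- `1 ≤ L_b`. [folklore] -/
theorem one_le_Lb : 1 ≤ P.Lbℓ := Nat.le_add_left 1 _

/-- `h L_b G ≤ 𝔘/c_L + h G`, i.e. **`h L_b G ≤ 𝔘/c_L + W⋆ + G`**. [folklore] -/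
theorem hparLbG_le : (P.hparℓ : ℝ) * P.Lbℓ * P.Gℓ ≤ P.𝔘ℓ / cLp + (P.Wstarℓ + P.Gℓ) := by
  have hh := P.hpar_pos; have hG := P.G_pos; have hU := P.U_pos
  have hLb : (P.Lbℓ : ℝ) ≤ P.Uℓ / (cLp * 2 ^ (d + 1) * P.Gℓ * P.hparℓ) + 1 := by
    unfold Lbℓ; push_cast
    have := Nat.floor_le (show 0 ≤ P.Uℓ / (cLp * 2 ^ (d + 1) * P.Gℓ * P.hparℓ) by unfold cLp; positivity)
    linarith
  have e : P.Uℓ / (cLp * 2 ^ (d + 1) * P.Gℓ * P.hparℓ) = P.𝔘ℓ / cLp / (P.Gℓ * P.hparℓ) := by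
    rw [P.U_eq]; unfold cLp; field_simp
  rw [e] at hLb
  have h2 := P.hparG_le
  calc (P.hparℓ : ℝ) * P.Lbℓ * P.Gℓ ≤ P.hparℓ * (P.𝔘ℓ / cLp / (P.Gℓ * P.hparℓ) + 1) * P.Gℓ := by gcongr
    _ = P.𝔘ℓ / cLp + P.hparℓ * P.Gℓ := by field_simp
    _ ≤ P.𝔘ℓ / cLp + (P.Wstarℓ + P.Gℓ) := by linarith

/-- `h L_b ≤ 𝔘/c_L + 4W⋆` (`G ≥ 1`, `G ≤ 3W⋆`). [folklore] -/
theorem hparLb_le : (P.hparℓ : ℝ) * P.Lbℓ ≤ P.𝔘ℓ / cLp + 4 * P.Wstarℓ := by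
  have h := P.hparLbG_le; have hG := P.one_le_G; have hGW := P.G_le_three_Wstar
  have h0 : 0 ≤ (P.hparℓ : ℝ) * P.Lbℓ := by positivity
  have hU : 0 ≤ P.𝔘ℓ / cLp := by unfold cLp; have := P.𝔘_pos; positivity
  nlinarith

/-- **`h L_b ℓ ≤ 𝔘/c_L + W⋆ + G`** (the floor `ℓ ≤ G`): the `(log p)`-normalised degree bound of the endgame and of
the Schwarz branch `hL_b · log p`. [folklore] -/
theorem hparLbℓ_le : (P.hparℓ : ℝ) * P.Lbℓ * P.ℓ ≤ P.𝔘ℓ / cLp + (P.Wstarℓ + P.Gℓ) := by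
  have h := P.hparLbG_le; have hG := P.ℓ_le_G
  have h0 : 0 ≤ (P.hparℓ : ℝ) * P.Lbℓ := by positivity
  exact (mul_le_mul_of_nonneg_left hG h0).trans h

/-! ### The largest evaluation point against `h`: `log((X+h)/h) ≤ 6G` -/

/-- `0 ≤ X`. [folklore] -/
theorem Xpt_nonneg : 0 ≤ P.Xptℓ := by unfold Xptℓ; positivity

/-- `X ≤ 33 U/(c_L' m V_θ)`. [folklore] -/
theorem Xpt_le : P.Xptℓ ≤ 33 * P.Uℓ / (cLp' * mRp d * P.Vθ) := by
  have hL := P.Lθ_le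
  have hS := P.S₀_pos; have hV := P.hVθ1; have hm := mR_pos P; have hU := P.U_pos
  unfold Xptℓ cLp' at *
  rw [le_div_iff₀ (by positivity)] at hL
  rw [le_div_iff₀ (by positivity)]
  have e : (2 : ℝ) ^ (d + 2) = 2 * 2 ^ (d + 1) := by rw [pow_succ]; ring
  rw [e] at hL
  have h2 : (0 : ℝ) < 2 ^ (d + 1) := by positivity
  nlinarith [mul_le_mul_of_nonneg_left hL h2.le]

/-- `Aᵐ m^{2m+1} ≤ e^{3G}`: `35m + 3m log m ≤ 3m(17 log 2 + log m) ≤ 3G`. [folklore] -/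
theorem A_pow_mul_le : Ap ^ (d + 1) * mRp d ^ (2 * d + 3) ≤ Real.exp (3 * P.Gℓ) := by
  have hm := two_le_mR P; have hm0 := mR_pos P; have hVf := P.hVmax1
  have hlogm : 0 ≤ Real.log (mRp d) := Real.log_nonneg (by linarith)
  have h2 : (2 : ℝ) ^ 50 ≤ Real.exp 35 := by
    have := Real.exp_one_gt_d9
    have h3 : (2.7182818283 : ℝ) ^ 35 ≤ Real.exp 1 ^ 35 := by gcongr
    rw [← Real.exp_nat_mul] at h3
    norm_num at h3 ⊢
    linarith
  have f1 : Ap ^ (d + 1) ≤ Real.exp (35 * mRp d) := by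
    unfold Ap
    calc ((2 : ℝ) ^ 50) ^ (d + 1) ≤ (Real.exp 35) ^ (d + 1) := by gcongr
      _ = Real.exp (35 * mRp d) := by rw [← Real.exp_nat_mul]; unfold mRp; push_cast; ring_nf
  have f2 : mRp d ^ (2 * d + 3) ≤ Real.exp (3 * mRp d * Real.log (mRp d)) := by
    calc mRp d ^ (2 * d + 3) = Real.exp ((2 * d + 3 : ℕ) * Real.log (mRp d)) := by
          rw [Real.exp_nat_mul, Real.exp_log hm0]
      _ ≤ Real.exp (3 * mRp d * Real.log (mRp d)) := by
          apply Real.exp_le_exp.mpr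
          have e : ((2 * d + 3 : ℕ) : ℝ) = 2 * mRp d + 1 := by unfold mRp; push_cast; ring
          rw [e]; nlinarith
  have hG : 35 * mRp d + 3 * mRp d * Real.log (mRp d) ≤ 3 * P.Gℓ := by
    unfold Gℓ
    have hlog : Real.log (2 ^ 17 * mRp d * P.Vm) = 17 * Real.log 2 + Real.log (mRp d) + Real.log P.Vm := by
      rw [Real.log_mul (by positivity) (by linarith), Real.log_mul (by positivity) hm0.ne', Real.log_pow]; push_cast; ring
    rw [hlog]
    have hl2 := Real.log_two_gt_d9
    have hlVf : 0 ≤ Real.log P.Vm := Real.log_nonneg hVf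
    have hℓ0 := P.ℓ_pos.le
    nlinarith
  calc Ap ^ (d + 1) * mRp d ^ (2 * d + 3) ≤ Real.exp (35 * mRp d) * Real.exp (3 * mRp d * Real.log (mRp d)) := by
        have : (0 : ℝ) ≤ Ap ^ (d + 1) := by unfold Ap; positivity
        gcongr
    _ = Real.exp (35 * mRp d + 3 * mRp d * Real.log (mRp d)) := by rw [← Real.exp_add]
    _ ≤ Real.exp (3 * P.Gℓ) := Real.exp_le_exp.mpr hG

/-- `∏ Vⱼ ≤ e^{G}` (`d log V_f ≤ m log(2¹⁷ m V_f) ≤ G`). [folklore] -/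
theorem prodV_le_exp_G : (∏ j, P.V j) ≤ Real.exp P.Gℓ := by
  have hm := two_le_mR P; have hm0 := mR_pos P; have hVf := P.hVmax1
  have h1 : (∏ j, P.V j) ≤ P.Vm ^ d := by
    calc (∏ j, P.V j) ≤ ∏ _j : Fin d, P.Vm := prod_le_prod (fun j _ => le_trans zero_le_one (P.hV j)) fun j _ => P.hVmax j
      _ = P.Vm ^ d := by rw [prod_const, card_univ, Fintype.card_fin]
  refine h1.trans ?_
  have hVf0 : 0 < P.Vm := by linarith
  rw [← Real.exp_log hVf0, ← Real.exp_nat_mul, Real.exp_le_exp]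
  have hlv : Real.log P.Vm ≤ Real.log (2 ^ 17 * mRp d * P.Vm) := by
    apply Real.log_le_log hVf0
    have : (1 : ℝ) ≤ 2 ^ 17 * mRp d := by nlinarith
    nlinarith
  have hlv0 : 0 ≤ Real.log P.Vm := Real.log_nonneg hVf
  have hd : (d : ℝ) ≤ mRp d := by unfold mRp; linarith
  calc (d : ℝ) * Real.log P.Vm ≤ mRp d * Real.log P.Vm := mul_le_mul_of_nonneg_right hd hlv0
    _ ≤ mRp d * Real.log (2 ^ 17 * mRp d * P.Vm) := mul_le_mul_of_nonneg_left hlv hm0.le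
    _ ≤ P.Gℓ := P.mlogG_le_G

/-- `G² ≤ e^{G}` (`e^{G/2} ≥ 1 + G/2 + G²/8 ≥ G`). [folklore] -/
theorem G_sq_le_exp_G : P.Gℓ ^ 2 ≤ Real.exp P.Gℓ := by
  have hG := P.G_pos
  have h := Real.quadratic_le_exp_of_nonneg (show 0 ≤ P.Gℓ / 2 by positivity)
  have h1 : P.Gℓ ≤ Real.exp (P.Gℓ / 2) := by nlinarith
  calc P.Gℓ ^ 2 ≤ Real.exp (P.Gℓ / 2) ^ 2 := pow_le_pow_left₀ hG.le h1 2
    _ = Real.exp P.Gℓ := by rw [← Real.exp_nat_mul]; ring_nf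

end PadicW80ParL

end Summit.ABC.StewartYu

end
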